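import Summits.CriticalPhenomena.PercolationContinuityZ3.Theorems.PercNearOneGluingNoHeavyPcintNawReduction
import HarnessLib

/-!
# PCINT lane, reduction B2r (certificate kind `nawrand_cw`): definitions

Cell `prim-pcint` (PAPER-2 track (iii): certified intervals for `p_c(ℤ^d)`), seat `prim-pcint-2`;
memo `run/shared/lean/prim/pcint/REDUCTIONS.md` §B2+, §B2r.  Does NOT build on p205010.

SITE percolation on `ℤ^d`.  Beyond "a shortest open path is neighbour-avoiding" (B2,
`siteTheta_le_card_nawWords_mul_pow`), a shortest open path that is moreover LEXICOGRAPHICALLY LEAST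
for a random family of sibling orders forces some OFF-path sites to be CLOSED:
* (gap) a lattice neighbour `w` of `v_t` off the path with an older incidence `w ~ v_i`, `i ≤ t-3`
  (an open `w` would shortcut the geodesic);
* (corner) for two consecutive perpendicular steps `a = γ_s`, `b = γ_{s+1}` the fourth site of the unit
  square, `w = v_s + b`, when the sibling order at the prefix node of length `s` puts `b` before `a`
  (an open `w` would give a lexicographically smaller open geodesic).
Averaging over the orders (independent uniformly random permutations of the `2d` directions at every
prefix node) charges every corner the factor `(1+q)/2` and every gap event the factor `q`, where
`q^{2d-1} ≥ 1-p` caps the at most `2d-1` charged events per closed site.  This file fixes the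
vocabulary; the forcing lemmas and the reduction
`θ^site(p) ≤ Σ_{γ NAW} p^{n+1} q^{gapTotal γ} ((1+q)/2)^{cornerTotal γ}` follow in
`…PcintNawRandForcing`, `…PcintNawRandReduction`.

Objects (namespace `Summit.CriticalPhenomena.PercolationContinuityZ3.Theorems.Pcint`):
`nbrSites`, `pathSites`, `gapSet`/`gapTotal`, `cornerSite`/`IsCorner`/`cornerTimes`/`cornerTotal`,
`nawRandWeight`; prefix nodes `PNode`, sibling orders `Orders`, `pnode`, `dirCode`, `digit`, `code`
(a `Lex (Fin n → ℕ)`), `IsBad`/`badTimes`, `cornerFactor`, `flipAt`; `gapPairs`/`badPairs`/`chargedPairs`/`forcedSites`,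
the cylinder event `nawRandEvent`, and the open-geodesic words `geoWords ω n`.
-/

noncomputable section

namespace Summit.CriticalPhenomena.PercolationContinuityZ3.Theorems.Pcint

open Finset Literature.Probability.Percolation Literature.Probability.LatticeModels

variable {d n : ℕ}

/-! ### Lattice neighbourhoods and the sites of a word -/

/-- The `2d` lattice neighbours `x ± e_i` of a site of `ℤ^d`. [folklore] -/
def nbrSites (x : Site d) : Finset (Site d) := univ.image fun a : Fin d × Bool => x + stepVec a

/-- Membership in `nbrSites` is lattice adjacency. [folklore] -/
theorem mem_nbrSites {x y : Site d} : y ∈ nbrSites x ↔ (zdGraph d).Adj x y := by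
  rw [nbrSites, mem_image, zdGraph_adj_iff_stepVec]
  constructor
  · rintro ⟨a, -, ha⟩; exact ⟨a, ha.symm⟩
  · rintro ⟨a, ha⟩; exact ⟨a, mem_univ _, ha.symm⟩

/-- A site has at most `2d` lattice neighbours. [folklore] -/
theorem card_nbrSites_le (x : Site d) : (nbrSites x).card ≤ 2 * d := by
  refine card_image_le.trans ?_
  rw [card_univ, Fintype.card_prod, Fintype.card_fin, Fintype.card_bool, mul_comm]

/-- The sites `v_0, …, v_n` visited by a word. [folklore] -/
def pathSites (γ : Fin n → Fin d × Bool) : Finset (Site d) := (range (n + 1)).image (wordPos γ)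

/-- Membership in `pathSites`. [folklore] -/
theorem mem_pathSites {γ : Fin n → Fin d × Bool} {x : Site d} :
    x ∈ pathSites γ ↔ ∃ i ≤ n, wordPos γ i = x := by
  simp only [pathSites, mem_image, mem_range, Nat.lt_succ_iff]

/-- A self-avoiding word visits `n + 1` distinct sites. [folklore] -/
theorem IsSAW.card_pathSites {γ : Fin n → Fin d × Bool} (h : IsSAW γ) : (pathSites γ).card = n + 1 := by
  rw [pathSites, card_image_of_injOn, card_range]
  intro i hi j hj hij
  simp only [coe_range, Set.mem_Iio] at hi hj
  exact h i j (by omega) (by omega) hij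

/-- The incidence times of a site along a word. [folklore] -/
def incTimes (γ : Fin n → Fin d × Bool) (w : Site d) : Finset ℕ :=
  (range (n + 1)).filter fun t => (zdGraph d).Adj (wordPos γ t) w

/-! ### Gap events and corner events along a word -/

/-- The GAP set at time `t`: lattice neighbours `w` of the new vertex `v_t`, off the path, with an
incidence `w ~ v_i` at least three steps older (`i + 3 ≤ t`).  Such a `w`, if open, would shortcut a
geodesic. [folklore] -/
def gapSet (γ : Fin n → Fin d × Bool) (t : ℕ) : Finset (Site d) :=
  (nbrSites (wordPos γ t)).filter fun w =>
    w ∉ pathSites γ ∧ ∃ i ∈ range t, i + 3 ≤ t ∧ (zdGraph d).Adj (wordPos γ i) w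

/-- Membership in `gapSet`. [folklore] -/
theorem mem_gapSet {γ : Fin n → Fin d × Bool} {t : ℕ} {w : Site d} :
    w ∈ gapSet γ t ↔ (zdGraph d).Adj (wordPos γ t) w ∧ w ∉ pathSites γ ∧
      ∃ i, i + 3 ≤ t ∧ (zdGraph d).Adj (wordPos γ i) w := by
  rw [gapSet, mem_filter, mem_nbrSites]
  constructor
  · rintro ⟨h1, h2, i, -, h3, h4⟩; exact ⟨h1, h2, i, h3, h4⟩
  · rintro ⟨h1, h2, i, h3, h4⟩; exact ⟨h1, h2, i, mem_range.2 (by omega), h3, h4⟩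

/-- Total number of gap events along the word (the exponent of `q`). [folklore] -/
def gapTotal (γ : Fin n → Fin d × Bool) : ℕ := ∑ t ∈ range (n + 1), (gapSet γ t).card

/-- The CORNER site of steps `s, s+1`: the fourth vertex `v_s + γ_{s+1}` of the unit square spanned by
two consecutive steps (junk `v_s` when `s + 1 ≥ n`). [folklore] -/
def cornerSite (γ : Fin n → Fin d × Bool) (s : ℕ) : Site d :=
  wordPos γ s + (if h : s + 1 < n then stepVec (γ ⟨s + 1, h⟩) else 0)

/-- A CORNER event at steps `s, s+1` (`s + 2 ≤ n`): the two steps are perpendicular, the corner site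
is off the path and has no incidence older than `v_s` (otherwise it is a gap event at time `s + 2`).
[folklore] -/
def IsCorner (γ : Fin n → Fin d × Bool) (s : ℕ) : Prop :=
  ∃ h : s + 2 ≤ n, (γ ⟨s, by omega⟩).1 ≠ (γ ⟨s + 1, by omega⟩).1 ∧ cornerSite γ s ∉ pathSites γ ∧
    ∀ i ∈ range s, ¬ (zdGraph d).Adj (wordPos γ i) (cornerSite γ s)

open Classical in
/-- The corner times of a word (as step indices). [folklore] -/
def cornerTimes (γ : Fin n → Fin d × Bool) : Finset (Fin n) := univ.filter fun s => IsCorner γ s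

/-- Membership in `cornerTimes`. [folklore] -/
theorem mem_cornerTimes {γ : Fin n → Fin d × Bool} {s : Fin n} : s ∈ cornerTimes γ ↔ IsCorner γ s := by
  classical
  rw [cornerTimes, mem_filter, and_iff_right (mem_univ _)]

/-- Number of corner events along the word (the exponent of `(1+q)/2`). [folklore] -/
def cornerTotal (γ : Fin n → Fin d × Bool) : ℕ := (cornerTimes γ).card

/-- The symmetric (order-averaged) B2r weight of a word: `p^{n+1} q^{gapTotal} ((1+q)/2)^{cornerTotal}`.
[folklore] -/
def nawRandWeight (p q : ℝ) (γ : Fin n → Fin d × Bool) : ℝ :=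
  p ^ (n + 1) * q ^ gapTotal γ * ((1 + q) / 2) ^ cornerTotal γ

/-! ### Sibling orders, digits, codes, flips -/

/-- Prefix nodes: a length `t < n` and a word of that length. [folklore] -/
abbrev PNode (d n : ℕ) : Type := (t : Fin n) × (Fin t → Fin d × Bool)

/-- A family of sibling orders: a permutation of the `2d` directions at every prefix node (the lane's
"random order", REDUCTIONS.md §B2r.1, is the uniform measure on this finite type). [folklore] -/
abbrev Orders (d n : ℕ) : Type := PNode d n → Equiv.Perm (Fin d × Bool)

/-- The prefix node of length `s` of a word. [folklore] -/
def pnode (γ : Fin n → Fin d × Bool) (s : Fin n) : PNode d n :=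
  ⟨s, fun i => γ (Fin.castLE (Nat.le_of_lt s.2) i)⟩

/-- A fixed numbering of the directions (`2·axis + sign`). [folklore] -/
def dirCode (a : Fin d × Bool) : ℕ := 2 * a.1.1 + (if a.2 then 0 else 1)

/-- `dirCode` is injective. [folklore] -/
theorem dirCode_injective : Function.Injective (dirCode (d := d)) := by
  rintro ⟨i, b⟩ ⟨j, c⟩ h
  simp only [dirCode] at h
  have hij : (i : ℕ) = j := by cases b <;> cases c <;> simp at h <;> omega
  have hbc : b = c := by cases b <;> cases c <;> simp at h ⊢ <;> omega
  exact Prod.ext (Fin.ext hij) hbc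

/-- The digit of step `t` of a word under the orders `o`: the number of the image of `γ_t` under the
permutation attached to the prefix node of length `t`. [folklore] -/
def digit (o : Orders d n) (γ : Fin n → Fin d × Bool) (t : Fin n) : ℕ := dirCode (o (pnode γ t) (γ t))

/-- The code of a word under `o`: its digit string, compared lexicographically. [folklore] -/
def code (o : Orders d n) (γ : Fin n → Fin d × Bool) : Lex (Fin n → ℕ) := toLex (digit o γ)

/-- The corner at steps `s, s+1` is BAD for `o`: the order at the prefix node of length `s` puts the
second step before the first (so the flipped word has a smaller code). [folklore] -/
def IsBad (o : Orders d n) (γ : Fin n → Fin d × Bool) (s : ℕ) : Prop :=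
  ∃ h : s + 2 ≤ n, dirCode (o (pnode γ ⟨s, by omega⟩) (γ ⟨s + 1, by omega⟩)) <
    dirCode (o (pnode γ ⟨s, by omega⟩) (γ ⟨s, by omega⟩))

open Classical in
/-- The bad corner times of a word under `o`. [folklore] -/
def badTimes (o : Orders d n) (γ : Fin n → Fin d × Bool) : Finset (Fin n) :=
  (cornerTimes γ).filter fun s => IsBad o γ s

/-- Membership in `badTimes`. [folklore] -/
theorem mem_badTimes {o : Orders d n} {γ : Fin n → Fin d × Bool} {s : Fin n} :
    s ∈ badTimes o γ ↔ IsCorner γ s ∧ IsBad o γ s := by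
  classical
  rw [badTimes, mem_filter, mem_cornerTimes]

/-- The corner factor of step pair `s, s+1` under a permutation `σ` of the directions: `q` if `σ`
puts the second step before the first, else `1` (junk `1` for `s + 2 > n`). [folklore] -/
def cornerFactor (q : ℝ) (γ : Fin n → Fin d × Bool) (s : Fin n) (σ : Equiv.Perm (Fin d × Bool)) : ℝ :=
  if h : (s : ℕ) + 2 ≤ n then
    (if dirCode (σ (γ ⟨s + 1, by omega⟩)) < dirCode (σ (γ ⟨s, by omega⟩)) then q else 1)
  else 1

/-- The word with steps `s` and `s + 1` exchanged. [folklore] -/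
def flipAt (γ : Fin n → Fin d × Bool) (s : ℕ) (h : s + 2 ≤ n) : Fin n → Fin d × Bool :=
  γ ∘ Equiv.swap (⟨s, by omega⟩ : Fin n) ⟨s + 1, by omega⟩

/-! ### Charged events, forced sites, the cylinder event, open geodesic words -/

/-- The gap events `(t, w)`, `w ∈ gapSet γ t`. [folklore] -/
def gapPairs (γ : Fin n → Fin d × Bool) : Finset (ℕ × Site d) :=
  (range (n + 1)).biUnion fun t => (gapSet γ t).image fun w => (t, w)

/-- The bad corner events `(s + 2, cornerSite γ s)`, `s ∈ badTimes o γ`. [folklore] -/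
def badPairs (o : Orders d n) (γ : Fin n → Fin d × Bool) : Finset (ℕ × Site d) :=
  (badTimes o γ).image fun s : Fin n => ((s : ℕ) + 2, cornerSite γ s)

/-- All charged events of a word under `o`. [folklore] -/
def chargedPairs (o : Orders d n) (γ : Fin n → Fin d × Bool) : Finset (ℕ × Site d) :=
  gapPairs γ ∪ badPairs o γ

/-- The sites forced CLOSED when `γ` is the `o`-least open geodesic: the sites of the charged events.
[folklore] -/
def forcedSites (o : Orders d n) (γ : Fin n → Fin d × Bool) : Finset (Site d) :=
  (chargedPairs o γ).image Prod.snd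

/-- The cylinder event "all sites of `γ` open, all forced sites closed". [folklore] -/
def nawRandEvent (o : Orders d n) (γ : Fin n → Fin d × Bool) : Set (SiteConfig (Site d)) :=
  {ω | (↑(pathSites γ) : Set (Site d)) ⊆ ω} ∩ {ω | ∀ w ∈ forcedSites o γ, w ∉ ω}

open Classical in
/-- The OPEN GEODESIC words of length `n` of a site configuration: all `n + 1` sites open and the
endpoint at open-graph distance exactly `n` from the origin. [folklore] -/
def geoWords (ω : SiteConfig (Site d)) (n : ℕ) : Finset (Fin n → Fin d × Bool) :=
  univ.filter fun γ => (∀ i ≤ n, wordPos γ i ∈ ω) ∧ (siteOpenGraph (zdGraph d) ω).dist 0 (wordPos γ n) = n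

/-- Membership in `geoWords`. [folklore] -/
theorem mem_geoWords {ω : SiteConfig (Site d)} {γ : Fin n → Fin d × Bool} :
    γ ∈ geoWords ω n ↔ (∀ i ≤ n, wordPos γ i ∈ ω) ∧ (siteOpenGraph (zdGraph d) ω).dist 0 (wordPos γ n) = n := by
  classical
  rw [geoWords, mem_filter, and_iff_right (mem_univ _)]

end Summit.CriticalPhenomena.PercolationContinuityZ3.Theorems.Pcint
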